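import Summits.Ventures.Crystal3D.Bulk.GapExtremal
import Summits.Ventures.Crystal3D.Bulk.GapForms
import HarnessLib

/-!
# P-L2(a) at the intruder: at an extremal configuration the hole contacts surround the hole
# direction (no closed tangent half-plane), in particular the intruder touches some shell ball

HONEST FRAMING. Part of the venture `Summits/Ventures/Crystal3D` (cell `pub-crystal3d`, phase 2,
24-hour sprint `PLAN.md` R42; seat typer-bulk-2). Companion of `Bulk/GapNoHalfPlane.lean` (the
same statement at SHELL vertices of a reduced extremal configuration, by a tight-pair-count
argument). At the INTRUDER the argument is by EXTREMALITY (minimal intruder distance,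
`Bulk/GapExtremal.lean`, cell file `DESIGN-L12-THEORY.md` P-L1(a)/P-L2(a),(c)): if every hole
contact direction `c j - c 0` (shell balls `j` touching the intruder) lay in a closed tangent
half-plane `⟪n, ·⟫ ≤ 0` at the hole direction `p`, tilting the intruder towards `n` at the same
distance would free it from all contacts (`exists_tilt_open`), and a free intruder can be pushed
radially inwards (`exists_radial_decrease`), contradicting minimality. Hence

* `IsExtremal.exists_inner_pos_intruder`: for every nonzero tangent `n` at `p` some shell ball
  touching the intruder has `⟪n, c j - c 0⟫ > 0`;
* `IsExtremal.exists_intruderContact`: the intruder of an extremal configuration touches at least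
  one shell ball (the census's "deg p ≥ 1"; `≥ 3` needs the planar version of this lemma).

Inputs: `coordination_eq_twelve_of_tuple` (`Bulk/GapForms.lean`: the intruder never touches the
centre, so `D > 1`) and elementary continuity. Nothing numerical; nothing claimed about GAP(1.26).
-/

noncomputable section

open scoped BigOperators InnerProductSpace Topology
open Finset Filter

namespace Summit.Ventures.Crystal3D

variable {c : Fin 14 → EuclideanSpace ℝ (Fin 3)}

/-! ## Elementary facts -/

/-- For unit vectors `y, u`, a scale `D > 0` and any `q`: `⟪y, q⟫ < ⟪u, q⟫ → dist (D u) q <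
dist (D y) q` (`dist (D v) q ² = D² - 2D⟪v, q⟫ + ‖q‖²`). -/
theorem dist_smul_lt_dist_smul_of_inner_lt {y u q : EuclideanSpace ℝ (Fin 3)} (hy : ‖y‖ = 1)
    (hu : ‖u‖ = 1) {D : ℝ} (hD : 0 < D) (h : ⟪y, q⟫_ℝ < ⟪u, q⟫_ℝ) :
    dist (D • u) q < dist (D • y) q := by
  have e : ∀ v : EuclideanSpace ℝ (Fin 3), ‖v‖ = 1 →
      dist (D • v) q ^ 2 = D ^ 2 - 2 * D * ⟪v, q⟫_ℝ + ‖q‖ ^ 2 := by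
    intro v hv
    rw [dist_eq_norm, norm_sub_sq_real, norm_smul, Real.norm_of_nonneg hD.le, hv,
      real_inner_smul_left]
    ring
  have hlt : dist (D • u) q ^ 2 < dist (D • y) q ^ 2 := by
    rw [e u hu, e y hy]; nlinarith
  exact lt_of_pow_lt_pow_left₀ 2 dist_nonneg hlt

/-- The intruder of an admissible configuration does not touch the centre: `D > 1` (kissing
number twelve, `coordination_eq_twelve_of_tuple`). -/
theorem IsGapConfig.one_lt_intruderDist (hc : IsGapConfig c) : 1 < intruderDist c :=
  lt_of_le_of_ne (hc.1 0 13 (by decide)) (Ne.symm (coordination_eq_twelve_of_tuple hc.1 hc.2).2)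

/-- In `ℝ³` every vector has a nonzero orthogonal vector. -/
theorem exists_ne_zero_inner_eq_zero (p : EuclideanSpace ℝ (Fin 3)) :
    ∃ n : EuclideanSpace ℝ (Fin 3), n ≠ 0 ∧ ⟪p, n⟫_ℝ = 0 := by
  classical
  set K : Submodule ℝ (EuclideanSpace ℝ (Fin 3)) :=
    Submodule.span ℝ ((({p} : Finset (EuclideanSpace ℝ (Fin 3))) : Set _)) with hKdef
  have hK : Kᗮ ≠ ⊥ := by
    intro hbot
    have h1 := Submodule.finrank_add_finrank_orthogonal K
    rw [hbot, finrank_bot, finrank_euclideanSpace_fin] at h1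
    have h2 : Module.finrank ℝ K ≤ 1 :=
      (finrank_span_finset_le_card ({p} : Finset (EuclideanSpace ℝ (Fin 3)))).trans (by simp)
    omega
  obtain ⟨n, hn, hn0⟩ := Submodule.exists_mem_ne_zero_of_ne_bot hK
  refine ⟨n, hn0, ?_⟩
  rw [Submodule.mem_orthogonal] at hn
  exact hn p (Submodule.subset_span (by simp))

/-! ## A free intruder can be pushed inwards -/

/-- **Radial decrease.** If the intruder of an admissible configuration touches NO shell ball,
moving it slightly towards the centre gives an admissible configuration with a strictly smaller
intruder distance. -/
theorem exists_radial_decrease (hc : IsGapConfig c)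
    (hfree : ∀ j : Fin 14, j ≠ 0 → j ≠ 13 → 1 < dist (c 13) (c j)) :
    ∃ c', IsGapConfig c' ∧ intruderDist c' < intruderDist c := by
  set D := intruderDist c with hDdef
  have hD1 : 1 < D := hc.one_lt_intruderDist
  -- the moved intruder `c 0 + t (c 13 - c 0)`
  set w : ℝ → EuclideanSpace ℝ (Fin 3) := fun t => c 0 + t • (c 13 - c 0) with hwdef
  have hwc : Continuous w := by
    simp only [hwdef]; exact continuous_const.add (continuous_id.smul continuous_const)
  have hw1 : w 1 = c 13 := by simp [hwdef]
  have hdist0 : ∀ t, 0 ≤ t → dist (w t) (c 0) = t * D := by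
    intro t ht
    simp only [hwdef]
    rw [dist_eq_norm, add_sub_cancel_left, norm_smul, Real.norm_of_nonneg ht, ← dist_eq_norm,
      dist_comm]
    rfl
  -- for `t < 1` close to `1`, all shell distances stay `> 1` and `t D ≥ 1`
  have hfar : ∀ᶠ t in 𝓝[<] (1 : ℝ), ∀ j : Fin 14, j ≠ 0 → j ≠ 13 → 1 < dist (w t) (c j) := by
    refine eventually_all.2 fun j => ?_
    by_cases hj0 : j = 0
    · exact Eventually.of_forall fun t h => absurd hj0 h
    by_cases hj13 : j = 13
    · exact Eventually.of_forall fun t _ h => absurd hj13 h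
    have hopen : IsOpen {v : EuclideanSpace ℝ (Fin 3) | 1 < dist v (c j)} :=
      isOpen_lt continuous_const (continuous_id.dist continuous_const)
    have hmem : {v : EuclideanSpace ℝ (Fin 3) | 1 < dist v (c j)} ∈ 𝓝 (w 1) := by
      rw [hw1]; exact hopen.mem_nhds (hfree j hj0 hj13)
    have ht : ∀ᶠ t in 𝓝[<] (1 : ℝ), w t ∈ {v : EuclideanSpace ℝ (Fin 3) | 1 < dist v (c j)} :=
      ((hwc.tendsto 1).mono_left nhdsWithin_le_nhds).eventually_mem hmem
    exact ht.mono fun t h _ _ => h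
  have hge : ∀ᶠ t in 𝓝[<] (1 : ℝ), 1 / D < t ∧ t < 1 := by
    have h1 : 1 / D < 1 := by rw [div_lt_one (by linarith)]; exact hD1
    have hIoo : Set.Ioo (1 / D) 1 ∈ 𝓝[<] (1 : ℝ) := Ioo_mem_nhdsLT h1
    exact Filter.mem_of_superset hIoo fun t ht => ht
  obtain ⟨t, ⟨htD, ht1⟩, htfar⟩ := (hge.and hfar).exists
  have ht0 : 0 ≤ t := le_trans (by positivity) htD.le
  have htD' : 1 < t * D := by
    have hDpos : (0 : ℝ) < D := by linarith
    calc (1 : ℝ) = 1 / D * D := by field_simp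
      _ < t * D := mul_lt_mul_of_pos_right htD hDpos
  refine ⟨Function.update c 13 (w t), ⟨fun a b hab => ?_, fun a ha0 ha13 => ?_⟩, ?_⟩
  · by_cases ha : a = 13
    · subst ha
      rw [Function.update_self, Function.update_of_ne (Ne.symm hab)]
      by_cases hb0 : b = 0
      · rw [hb0, hdist0 t ht0]; exact htD'.le
      · exact (htfar b hb0 (Ne.symm hab)).le
    by_cases hb : b = 13
    · subst hb
      rw [Function.update_self, Function.update_of_ne ha, dist_comm]
      by_cases ha0 : a = 0
      · rw [ha0, hdist0 t ht0]; exact htD'.le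
      · exact (htfar a ha0 ha).le
    rw [Function.update_of_ne ha, Function.update_of_ne hb]
    exact hc.1 a b hab
  · rw [Function.update_of_ne ha13, Function.update_of_ne (show (0 : Fin 14) ≠ 13 by decide)]
    exact hc.2 a ha0 ha13
  · unfold intruderDist
    rw [Function.update_of_ne (show (0 : Fin 14) ≠ 13 by decide), Function.update_self,
      dist_comm, hdist0 t ht0]
    calc t * D < 1 * D := mul_lt_mul_of_pos_right ht1 (by linarith)
      _ = D := one_mul _

/-! ## Tilting the intruder -/

/-- **Tilt.** If every shell ball touching the intruder has its direction in the closed tangent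
half-space `⟪n, ·⟫ ≤ 0` at the hole direction (`n ≠ 0` tangent), then tilting the intruder
towards `n` at the same distance frees it from every shell ball. -/
theorem exists_tilt_open (hc : IsGapConfig c) {n : EuclideanSpace ℝ (Fin 3)} (hn : n ≠ 0)
    (hnt : ⟪c 13 - c 0, n⟫_ℝ = 0)
    (hle : ∀ j : Fin 14, j ≠ 0 → j ≠ 13 → dist (c 13) (c j) = 1 → ⟪n, c j - c 0⟫_ℝ ≤ 0) :
    ∃ y : EuclideanSpace ℝ (Fin 3), ‖y‖ = 1 ∧
      ∀ j : Fin 14, j ≠ 0 → j ≠ 13 → 1 < dist (c 0 + intruderDist c • y) (c j) := by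
  set D := intruderDist c with hDdef
  have hD1 : 1 < D := hc.one_lt_intruderDist
  have hDpos : 0 < D := by linarith
  -- the hole direction
  obtain ⟨p, hpdef⟩ : ∃ p : EuclideanSpace ℝ (Fin 3), p = D⁻¹ • (c 13 - c 0) := ⟨_, rfl⟩
  have hnorm13 : ‖c 13 - c 0‖ = D := by rw [← dist_eq_norm, dist_comm]; rfl
  have hp : ‖p‖ = 1 := by
    rw [hpdef, norm_smul, Real.norm_of_nonneg (inv_nonneg.2 hDpos.le), hnorm13,
      inv_mul_cancel₀ hDpos.ne']
  have h13 : c 13 - c 0 = D • p := by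
    rw [hpdef, smul_smul, mul_inv_cancel₀ hDpos.ne', one_smul]
  have hpn : ⟪p, n⟫_ℝ = 0 := by
    rw [hpdef, real_inner_smul_left, hnt, mul_zero]
  -- the tilted directions
  set z : ℝ → EuclideanSpace ℝ (Fin 3) := fun ε => p + ε • n with hzdef
  have hz2 : ∀ ε, ‖z ε‖ ^ 2 = 1 + ε ^ 2 * ‖n‖ ^ 2 := by
    intro ε
    simp only [hzdef]
    rw [norm_add_sq_real, hp, real_inner_smul_right, hpn, norm_smul, mul_pow,
      Real.norm_eq_abs, sq_abs]
    ring
  have hz1 : ∀ ε, 0 < ε → 1 < ‖z ε‖ := by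
    intro ε hε
    have hn2 : 0 < ‖n‖ ^ 2 := by positivity
    have : 1 < ‖z ε‖ ^ 2 := by rw [hz2]; nlinarith [mul_pos (pow_pos hε 2) hn2]
    exact lt_of_pow_lt_pow_left₀ 2 (norm_nonneg _) (by simpa using this)
  set y : ℝ → EuclideanSpace ℝ (Fin 3) := fun ε => ‖z ε‖⁻¹ • z ε with hydef
  have hy1 : ∀ ε, 0 < ε → ‖y ε‖ = 1 := by
    intro ε hε
    have h0 : ‖z ε‖ ≠ 0 := by linarith [hz1 ε hε]
    simp only [hydef]
    rw [norm_smul, norm_inv, norm_norm, inv_mul_cancel₀ h0]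
  have hdist : ∀ (v : EuclideanSpace ℝ (Fin 3)) (j : Fin 14),
      dist (c 0 + D • v) (c j) = dist (D • v) (c j - c 0) := by
    intro v j
    rw [dist_eq_norm, dist_eq_norm]; congr 1; abel
  -- contacts open up for every `ε > 0`
  have htight : ∀ ε, 0 < ε → ∀ j : Fin 14, j ≠ 0 → j ≠ 13 → dist (c 13) (c j) = 1 →
      1 < dist (c 0 + D • y ε) (c j) := by
    intro ε hε j hj0 hj13 hd
    set q : EuclideanSpace ℝ (Fin 3) := c j - c 0 with hqdef
    have hdq : dist (D • p) q = 1 := by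
      rw [← h13, hqdef, dist_sub_right]; exact hd
    have hq1 : ‖q‖ = 1 := by rw [hqdef, ← dist_eq_norm]; exact hc.2 j hj0 hj13
    -- `⟪p, q⟫ = D/2 > 0`
    have hpos : 0 < ⟪p, q⟫_ℝ := by
      have hsq : dist (D • p) q ^ 2 = D ^ 2 - 2 * D * ⟪p, q⟫_ℝ + ‖q‖ ^ 2 := by
        rw [dist_eq_norm, norm_sub_sq_real, norm_smul, Real.norm_of_nonneg hDpos.le, hp,
          real_inner_smul_left]
        ring
      rw [hdq, hq1] at hsq
      nlinarith [hsq, hDpos]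
    have hin : ⟪y ε, q⟫_ℝ = ‖z ε‖⁻¹ * (⟪p, q⟫_ℝ + ε * ⟪n, q⟫_ℝ) := by
      simp only [hydef, hzdef]
      rw [real_inner_smul_left, inner_add_left, real_inner_smul_left]
    have hz := hz1 ε hε
    have hzinv : ‖z ε‖⁻¹ < 1 := inv_lt_one_of_one_lt₀ hz
    have hzinv0 : 0 < ‖z ε‖⁻¹ := inv_pos.2 (by linarith)
    have hlt : ⟪y ε, q⟫_ℝ < ⟪p, q⟫_ℝ := by
      rw [hin]
      have h1 : ⟪p, q⟫_ℝ + ε * ⟪n, q⟫_ℝ ≤ ⟪p, q⟫_ℝ := by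
        nlinarith [mul_nonpos_of_nonneg_of_nonpos hε.le (hle j hj0 hj13 hd)]
      calc ‖z ε‖⁻¹ * (⟪p, q⟫_ℝ + ε * ⟪n, q⟫_ℝ) ≤ ‖z ε‖⁻¹ * ⟪p, q⟫_ℝ :=
            mul_le_mul_of_nonneg_left h1 hzinv0.le
        _ < 1 * ⟪p, q⟫_ℝ := mul_lt_mul_of_pos_right hzinv hpos
        _ = ⟪p, q⟫_ℝ := one_mul _
    have := dist_smul_lt_dist_smul_of_inner_lt (hy1 ε hε) hp hDpos hlt
    rw [hdq] at this
    rwa [hdist]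
  -- continuity for the non-contacts
  have hcont : Tendsto y (𝓝[>] 0) (𝓝 p) := by
    have hzc : Continuous z := by
      simp only [hzdef]; exact continuous_const.add (continuous_id.smul continuous_const)
    have hz0 : z 0 = p := by simp [hzdef]
    have hnc : ContinuousAt (fun ε => ‖z ε‖⁻¹) 0 := by
      refine (hzc.norm.continuousAt).inv₀ ?_
      rw [hz0, hp]; exact one_ne_zero
    have hyc : ContinuousAt y 0 := by
      simp only [hydef]; exact hnc.smul hzc.continuousAt
    have hy0 : y 0 = p := by simp only [hydef]; rw [hz0, hp]; simp
    have := hyc.tendsto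
    rw [hy0] at this
    exact this.mono_left nhdsWithin_le_nhds
  have hfar : ∀ᶠ ε in 𝓝[>] (0 : ℝ), ∀ j : Fin 14, j ≠ 0 → j ≠ 13 → dist (c 13) (c j) ≠ 1 →
      1 < dist (c 0 + D • y ε) (c j) := by
    refine eventually_all.2 fun j => ?_
    by_cases hj0 : j = 0
    · exact Eventually.of_forall fun ε h => absurd hj0 h
    by_cases hj13 : j = 13
    · exact Eventually.of_forall fun ε _ h => absurd hj13 h
    by_cases hd : dist (c 13) (c j) = 1
    · exact Eventually.of_forall fun ε _ _ h => absurd hd h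
    · have hgt : 1 < dist (c 0 + D • p) (c j) := by
        have e : c 0 + D • p = c 13 := by rw [← h13]; abel
        rw [e]; exact lt_of_le_of_ne (hc.1 13 j (Ne.symm hj13)) (Ne.symm hd)
      have hcv : Continuous fun v : EuclideanSpace ℝ (Fin 3) => c 0 + D • v :=
        continuous_const.add (continuous_id.const_smul D)
      have hopen : IsOpen {v : EuclideanSpace ℝ (Fin 3) | 1 < dist (c 0 + D • v) (c j)} :=
        isOpen_lt continuous_const (hcv.dist continuous_const)
      have hmem : {v : EuclideanSpace ℝ (Fin 3) | 1 < dist (c 0 + D • v) (c j)} ∈ 𝓝 p :=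
        hopen.mem_nhds hgt
      exact (hcont.eventually_mem hmem).mono fun ε hε _ _ _ => hε
  have hposε : ∀ᶠ ε in 𝓝[>] (0 : ℝ), 0 < ε := eventually_nhdsWithin_of_forall fun ε hε => hε
  obtain ⟨ε, hε, hεfar⟩ := (hposε.and hfar).exists
  refine ⟨y ε, hy1 ε hε, fun j hj0 hj13 => ?_⟩
  by_cases hd : dist (c 13) (c j) = 1
  · exact htight ε hε j hj0 hj13 hd
  · exact hεfar j hj0 hj13 hd

/-- The tilted configuration (intruder at `c 0 + D • y`, all shell distances `> 1`) is admissible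
with the same intruder distance. -/
theorem isGapConfig_update_intruder (hc : IsGapConfig c) {y : EuclideanSpace ℝ (Fin 3)}
    (hy : ‖y‖ = 1)
    (hopen : ∀ j : Fin 14, j ≠ 0 → j ≠ 13 → 1 < dist (c 0 + intruderDist c • y) (c j)) :
    IsGapConfig (Function.update c 13 (c 0 + intruderDist c • y)) ∧
      intruderDist (Function.update c 13 (c 0 + intruderDist c • y)) = intruderDist c := by
  have hD1 : 1 < intruderDist c := hc.one_lt_intruderDist
  have hd0 : dist (c 0 + intruderDist c • y) (c 0) = intruderDist c := by
    rw [dist_eq_norm, add_sub_cancel_left, norm_smul, hy, mul_one,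
      Real.norm_of_nonneg (by linarith)]
  refine ⟨⟨fun a b hab => ?_, fun a ha0 ha13 => ?_⟩, ?_⟩
  · by_cases ha : a = 13
    · subst ha
      rw [Function.update_self, Function.update_of_ne (Ne.symm hab)]
      by_cases hb0 : b = 0
      · rw [hb0, hd0]; exact hD1.le
      · exact (hopen b hb0 (Ne.symm hab)).le
    by_cases hb : b = 13
    · subst hb
      rw [Function.update_self, Function.update_of_ne ha, dist_comm]
      by_cases ha0 : a = 0
      · rw [ha0, hd0]; exact hD1.le
      · exact (hopen a ha0 ha).le
    rw [Function.update_of_ne ha, Function.update_of_ne hb]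
    exact hc.1 a b hab
  · rw [Function.update_of_ne ha13, Function.update_of_ne (show (0 : Fin 14) ≠ 13 by decide)]
    exact hc.2 a ha0 ha13
  · unfold intruderDist
    rw [Function.update_of_ne (show (0 : Fin 14) ≠ 13 by decide), Function.update_self,
      dist_comm]
    exact hd0

/-! ## P-L2(a) at the intruder -/

/-- **The hole contacts surround the hole direction** (DESIGN-L12-THEORY P-L1(a)/P-L2(a) at `p`,
Musin–Tarasov 2012 Prop. 3.6 (i) analogue): at an EXTREMAL configuration, for every nonzero tangent
vector `n` at the hole direction `c 13 - c 0`, some shell ball `j` touching the intruder has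
`⟪n, c j - c 0⟫ > 0`. Otherwise tilt (`exists_tilt_open`) then push inwards
(`exists_radial_decrease`): a smaller intruder distance, contradicting extremality. -/
theorem IsExtremal.exists_inner_pos_intruder (hc : IsExtremal c) {n : EuclideanSpace ℝ (Fin 3)}
    (hn : n ≠ 0) (hnt : ⟪c 13 - c 0, n⟫_ℝ = 0) :
    ∃ j : Fin 14, j ≠ 0 ∧ j ≠ 13 ∧ dist (c 13) (c j) = 1 ∧ 0 < ⟪n, c j - c 0⟫_ℝ := by
  by_contra h
  push Not at h
  obtain ⟨y, hy, hopen⟩ := exists_tilt_open hc.1 hn hnt h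
  obtain ⟨hc', hD'⟩ := isGapConfig_update_intruder hc.1 hy hopen
  have hfree : ∀ j : Fin 14, j ≠ 0 → j ≠ 13 →
      1 < dist (Function.update c 13 (c 0 + intruderDist c • y) 13)
        (Function.update c 13 (c 0 + intruderDist c • y) j) := by
    intro j hj0 hj13
    rw [Function.update_self, Function.update_of_ne hj13]
    exact hopen j hj0 hj13
  obtain ⟨c'', hc'', hlt⟩ := exists_radial_decrease hc' hfree
  rw [hD'] at hlt
  exact absurd (hc.2 c'' hc'') (not_le.2 hlt)

/-- **The intruder of an extremal configuration touches at least one shell ball.** -/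
theorem IsExtremal.exists_intruderContact (hc : IsExtremal c) :
    ∃ j : Fin 14, j ≠ 0 ∧ j ≠ 13 ∧ dist (c 13) (c j) = 1 := by
  obtain ⟨n, hn, hnt⟩ := exists_ne_zero_inner_eq_zero (c 13 - c 0)
  obtain ⟨j, hj0, hj13, hd, -⟩ := hc.exists_inner_pos_intruder hn hnt
  exact ⟨j, hj0, hj13, hd⟩

end Summit.Ventures.Crystal3D

end
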